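import Summits.CriticalPhenomena.PercolationContinuityZ3.Theorems.FK.SamePContinuationLaws
import Summits.CriticalPhenomena.PercolationContinuityZ3.Theorems.FK.SamePPinnedLaws
import Summits.CriticalPhenomena.PercolationContinuityZ3.Theorems.FK.EdgeDensityDerivativeWeights
import HarnessLib

/-!
# FK-continuity transplant, FO-11 (3d/4, part ii): the continuation principle for PINNED robustly lawful
# schemes — the cell's crux C2 over C1 (Level C), `q ≥ 1`

Cell `fk-continuity` (bschramm), row FO-11 (C2); support file for the FK-continuity transplant
(`--supports stmt-CriticalPhenomena-4575`); builds on p205010 (kernel theorem, internal audit signed; external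
expert review pending).  No named facts, no sorries, standard axioms.

`SameP.PinnedLawful S q p ε N dirs reg bad` is, field for field, the cell's crux C1 `FKRobustLawful` (row FO-05,
"Level C") written over the tree's `HSiteScheme` with the per-direction data (`dirs`, `reg`, `bad`) as explicit
functions and the minimal law `SameP.pinnedLaw` (= FO-05's `FKScheme.law`, definitionally): probes made along
lattice configurations; `U₀ ⊆ E(ℤ^d)`; the failure of the probe after every history covered by finitely many
DECREASING bad events, each determined by the lattice edges of its region, each region with at most `N` fresh
lattice edges; and the bad events of total probability at most `ε` under the PINNED laws of their regions at the
scheme's own parameter `p`.  This file proves the continuation principle for such schemes: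

* `pinnedLaw_abs_real_sub_le` — the pinned laws are Lipschitz in the lattice parameter on a margin interval, with
  constant `N/(δ(1-δ))` (Grimmett 2006 Thm (2.43); cell row FO-09 `FK.abs_rcMeasureW_real_sub_le`: the two
  weightings differ only on the `≤ N` fresh edges);
* `PinnedLawful.lawLawful` — a pinned robustly lawful scheme is `LawLawful` (file 3b) for the class of FREE box
  limits, with `c(p′,h,e) = Σ_du pinnedLaw(p′)(bad)`: `dom` is the DLR step `IsBoxLimit.real_inter_le_fkLaw_mul`
  (file 3c) applied to the fresh reductions of the bad events (file 3d-i: `inter_pinReduce_eq_inter`,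
  `pinnedLaw_real_pinReduce_eq`);
* **C2** `PinnedLawful.rcCriticalProb_lt`: `ε < 2⁻³²`, `0 < p < 1`, `q ≥ 1`, infinite macro-cluster forcing
  `0 ↔ ∞` ⇒ `p_c(q) < p`, given that a free box limit satisfying the `FKGibbs` sandwich exists at every density
  (cell rows FO-06a-2 / FO-06b: `IsBoxLimit.fkGibbs`, `isBoxLimit_rcLimit`) — the cell's `FKContinuationPrinciple d q`
  (row FO-05) modulo that existence input.

## References

* G. Kozma, S. Nitzan, arXiv:2401.12397 (2024), §1 p. 2 (approach 1), §4 pp. 25–28. [KozmaNitzan2024]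
* G. Grimmett, *The Random-Cluster Model*, Springer 2006: Thm (2.43) p. 34, Lemma (4.13) p. 71, (4.14)(b) p. 72,
  (5.2), Prop. (5.11) p. 100. [Grimmett2006]
-/

noncomputable section

namespace Summit.CriticalPhenomena.PercolationContinuityZ3.Theorems.FK

open MeasureTheory Filter Literature.Probability.Percolation Literature.Probability.LatticeModels
open Literature.Probability.Percolation.ProbeHistory Literature.Probability.Percolation.HSiteScheme
open Literature.Probability.Percolation.KozmaNitzan (opens)
open Literature.Barriers.CriticalPhenomena
open scoped ENNReal Classical Topology

namespace SameP

variable {d : ℕ}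

/-! ### Lipschitz continuity of the pinned laws in the lattice parameter -/

/-- **The pinned laws are Lipschitz in the lattice parameter** (Grimmett 2006, Thm (2.43)/(2.44); the cell's
`FK.abs_rcMeasureW_real_sub_le`): the weightings at `p₁`, `p₂` differ only on the fresh lattice edges of the region,
where they are the constants `p₁`, `p₂`; for a region with at most `N` fresh edges and `p₁, p₂ ∈ (0,1)`,
`|pinnedLaw(p₂)(D) - pinnedLaw(p₁)(D)| ≤ N / min{p₁(1-p₁), p₂(1-p₂)} · |p₂ - p₁|`.
[cite: Grimmett2006, Thm (2.43) eq. (2.44)] -/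
theorem pinnedLaw_abs_real_sub_le (S : HSiteScheme (Site d)) {q : ℝ} (hq : 0 < q) {p₁ p₂ : unitInterval}
    (hp₁ : (p₁ : ℝ) ∈ Set.Ioo (0 : ℝ) 1) (hp₂ : (p₂ : ℝ) ∈ Set.Ioo (0 : ℝ) 1) (h : ProbeHistory (Site d))
    (R : Finset (Site d)) {N : ℕ} (hN : (freshOf S h R).card ≤ N) {D : Set (BondConfig (Site d))}
    (hD : MeasurableSet D) :
    |(pinnedLaw S q p₂ h R).real D - (pinnedLaw S q p₁ h R).real D| ≤
      N / min ((p₁ : ℝ) * (1 - p₁)) ((p₂ : ℝ) * (1 - p₂)) * |(p₂ : ℝ) - p₁| := by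
  set F : Finset (Sym2 ↥R) := Finset.univ.filter fun e => Sym2.map Subtype.val e ∈ freshOf S h R with hF
  have hreal : ∀ p : unitInterval, (pinnedLaw S q p h R).real D =
      (rcMeasureW (fun e : Sym2 ↥R => pinnedW S p h R (Sym2.map Subtype.val e)) q (∅ : Set ↥R)).real
        (liftEdges R ⁻¹' D) := fun p => by
    rw [pinnedLaw, fkLaw, map_measureReal_apply (measurable_liftEdges R) hD]
  rw [hreal, hreal]
  have key := abs_rcMeasureW_real_sub_le (V := ↥R) (F := F)
    (w := fun e : Sym2 ↥R => pinnedW S p₁ h R (Sym2.map Subtype.val e))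
    (w' := fun e : Sym2 ↥R => pinnedW S p₂ h R (Sym2.map Subtype.val e)) hp₁ hp₂
    (fun e he => by simp only [hF, Finset.mem_filter] at he; rw [pinnedW_apply_of_mem_freshOf he.2])
    (fun e he => by simp only [hF, Finset.mem_filter] at he; rw [pinnedW_apply_of_mem_freshOf he.2])
    (fun e he => by
      simp only [hF, Finset.mem_filter, Finset.mem_univ, true_and] at he
      exact (pinnedW_congr_of_not_mem_freshOf he).symm) hq (∅ : Set ↥R) (liftEdges R ⁻¹' D)
  refine key.trans (mul_le_mul_of_nonneg_right ?_ (abs_nonneg _))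
  have hmin : 0 < min ((p₁ : ℝ) * (1 - p₁)) ((p₂ : ℝ) * (1 - p₂)) :=
    lt_min (mul_pos hp₁.1 (by linarith [hp₁.2])) (mul_pos hp₂.1 (by linarith [hp₂.2]))
  refine div_le_div_of_nonneg_right ?_ hmin.le
  -- `#F ≤ #fresh ≤ N`
  have hcard : F.card ≤ (freshOf S h R).card :=
    Finset.card_le_card_of_injOn (fun e => Sym2.map Subtype.val e)
      (fun e he => by simpa [hF] using he)
      (fun e₁ _ e₂ _ h12 => Sym2.map.injective Subtype.val_injective h12)
  exact_mod_cast hcard.trans hN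

/-! ### Pinned robustly lawful schemes (cell crux C1, Level C) -/

/-- **`PinnedLawful S q p ε N dirs reg bad` — the scheme `S` is robustly lawful for FK(`q`) at lattice parameter
`p`, pinned form** (cell row FO-05's `FKRobustLawful`, field for field, over the tree's `HSiteScheme`): probes are
made along lattice configurations; `U₀ ⊆ E(ℤ^d)`; after every history `h` with a probe `P` along the chosen
macro-edge `e`, the failure of the probe is covered by the bad events of the onward directions `dirs h e`; each
bad event is DECREASING and determined by the lattice edges of its region `reg h e du`; each region has at most `N`
fresh lattice edges; and the bad events have total probability at most `ε` under the PINNED laws of their regions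
(`SameP.pinnedLaw`: fresh lattice edges at density `p`, revealed pattern pinned, free outside the region).
[cite: KozmaNitzan2024, §4 p. 25 (Definition, (4) = (28)), pp. 28–31 ((32)–(33))] -/
structure PinnedLawful (S : HSiteScheme (Site d)) (q : ℝ) (p : unitInterval) (ε : ℝ) (N : ℕ)
    (dirs : ProbeHistory (Site d) → Site 2 × MDir → Finset MDir)
    (reg : ProbeHistory (Site d) → Site 2 × MDir → MDir → Finset (Site d))
    (bad : ProbeHistory (Site d) → Site 2 × MDir → MDir → Set (BondConfig (Site d))) : Prop where
  /-- along the run on a lattice configuration, a probe is made whenever a candidate exists -/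
  probes : ∀ ω : BondConfig (Site d), ω ⊆ (zdGraph d).edgeSet → ∀ n,
    (S.stN n ω).choice ≠ none → S.E.next (S.E.hist n ω) ≠ none
  /-- the initial edges are lattice edges -/
  U₀_subset : (↑S.U₀ : Set (Sym2 (Site d))) ⊆ (zdGraph d).edgeSet
  /-- the failure of the probe is covered by the bad events of the onward directions -/
  cover : ∀ h P e, S.E.next h = some P → (S.mst h).choice = some e →
    {ω | ¬S.succ h e (P.read ω)} ⊆ ⋃ du ∈ dirs h e, bad h e du
  /-- bad events are decreasing -/
  lower : ∀ h e du, IsLowerSet (bad h e du)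
  /-- bad events are determined by the lattice edges of their region -/
  determined : ∀ h e du, DeterminedBy (bad h e du) ↑(edgesIn (zdGraph d) (reg h e du))
  /-- regions have at most `N` fresh lattice edges -/
  freshCard : ∀ h P e, S.E.next h = some P → (S.mst h).choice = some e →
    ∀ du ∈ dirs h e, (freshOf S h (reg h e du)).card ≤ N
  /-- the pinned-law failure bound at the scheme's own parameter -/
  fail : ∀ h P e, S.E.next h = some P → (S.mst h).choice = some e →
    ∑ du ∈ dirs h e, (pinnedLaw S q p h (reg h e du)).real (bad h e du) ≤ ε

/-- The sum of the pinned-law failure probabilities at lattice parameter `p′` (projected to `[0,1]`): the abstract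
failure numbers `c p′ h e` of `SameP.LawLawful` for a pinned scheme. [cite: KozmaNitzan2024, §4 p. 28 ((32))] -/
def pinnedFail (S : HSiteScheme (Site d)) (q : ℝ)
    (dirs : ProbeHistory (Site d) → Site 2 × MDir → Finset MDir)
    (reg : ProbeHistory (Site d) → Site 2 × MDir → MDir → Finset (Site d))
    (bad : ProbeHistory (Site d) → Site 2 × MDir → MDir → Set (BondConfig (Site d)))
    (p' : ℝ) (h : ProbeHistory (Site d)) (e : Site 2 × MDir) : ℝ :=
  ∑ du ∈ dirs h e, (pinnedLaw S q (Set.projIcc 0 1 zero_le_one p') h (reg h e du)).real (bad h e du)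

/-- Initial edges which are lattice edges lie in the edge set of a finite region. [folklore] -/
theorem exists_subset_edgesIn_of_subset_edgeSet {U : Finset (Sym2 (Site d))}
    (hU : (↑U : Set (Sym2 (Site d))) ⊆ (zdGraph d).edgeSet) :
    ∃ Λ₀ : Finset (Site d), (↑U : Set (Sym2 (Site d))) ⊆ ↑(edgesIn (zdGraph d) Λ₀) := by
  refine ⟨U.image (fun e => (Quot.out e : Site d × Site d).1) ∪ U.image (fun e => (Quot.out e : Site d × Site d).2),
    fun e he => ?_⟩
  rw [Finset.mem_coe, mem_edgesIn_iff]
  refine ⟨hU he, fun x hx => ?_⟩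
  have hmk : s((Quot.out e : Site d × Site d).1, (Quot.out e : Site d × Site d).2) = e := Quot.out_eq e
  rw [← hmk, Sym2.mem_iff] at hx
  rcases hx with rfl | rfl
  · exact Finset.mem_union_left _ (Finset.mem_image_of_mem _ (Finset.mem_coe.1 he))
  · exact Finset.mem_union_right _ (Finset.mem_image_of_mem _ (Finset.mem_coe.1 he))

namespace PinnedLawful

variable {S : HSiteScheme (Site d)} {q : ℝ} {p : unitInterval} {ε : ℝ} {N : ℕ}
  {dirs : ProbeHistory (Site d) → Site 2 × MDir → Finset MDir}
  {reg : ProbeHistory (Site d) → Site 2 × MDir → MDir → Finset (Site d)}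
  {bad : ProbeHistory (Site d) → Site 2 × MDir → MDir → Set (BondConfig (Site d))}

/-- **The DLR step for a pinned scheme**: under a free box limit `P′` at `(p′, q ≥ 1)`, after every history the
probe fails with conditional probability at most `pinnedFail … p′ h e` given the past (file 3c applied to the fresh
reductions of the bad events, file 3d-i). [cite: Grimmett2006, Lemma (4.13) and Lemma (4.14)(b)] -/
theorem dom (hR : PinnedLawful S q p ε N dirs reg bad) (hq : 1 ≤ q) {p' : ℝ} (hp' : p' ∈ Set.Icc (0 : ℝ) 1)
    {P : Measure (BondConfig (Site d))} (hP : IsBoxLimit d false p' q P) (n : ℕ) {h : ProbeHistory (Site d)}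
    {Pr : AProbe (Site d)} {e : Site 2 × MDir} (hPr : S.E.next h = some Pr) (he : (S.mst h).choice = some e) :
    P.real (S.initEvent ∩ {ω | S.E.hist n ω = h} ∩ {ω | ¬S.succ h e (Pr.read ω)}) ≤
      pinnedFail S q dirs reg bad p' h e * P.real (S.initEvent ∩ {ω | S.E.hist n ω = h}) := by
  haveI := hP.isProbabilityMeasure
  have hq0 : 0 < q := one_pos.trans_le hq
  set pI : unitInterval := Set.projIcc 0 1 zero_le_one p' with hpI
  have hpIval : (pI : ℝ) = p' := by rw [hpI, Set.projIcc_of_mem _ hp']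
  set H : Set (BondConfig (Site d)) := S.initEvent ∩ {ω | S.E.hist n ω = h} with hH
  have hHT : DeterminedBy H ↑(S.U₀ ∪ supp h) := by
    rw [Finset.coe_union]
    exact (determinedBy_initEvent.mono Set.subset_union_left).inter
      ((S.E.determinedBy_hist n h).mono Set.subset_union_right)
  have hHI : H ⊆ {ω | (↑(S.U₀ ∪ opens h) : Set (Sym2 (Site d))) ⊆ ω} := by
    rintro ω ⟨hA, hh⟩
    rw [Set.mem_setOf_eq, Finset.coe_union]
    exact Set.union_subset hA (opens_subset_of_hist_eq S.E hh)
  -- per direction: the fresh reduction of the bad event and the DLR step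
  have hdu : ∀ du ∈ dirs h e, P.real (bad h e du ∩ H) ≤ (pinnedLaw S q pI h (reg h e du)).real (bad h e du) * P.real H := by
    intro du _
    set R := reg h e du with hRdef
    set D' := pinReduce (freshOf S h R) (edgesIn (zdGraph d) R ∩ revealedOf S h ∩ patternOf S h) (bad h e du)
    rw [← inter_pinReduce_eq_inter S n h R (hR.determined h e du), ← pinnedLaw_real_pinReduce_eq hq0 (hR.determined h e du)]
    exact hP.real_inter_le_fkLaw_mul hp' hq R (pinnedW S pI h R) (freshOf S h R) (S.U₀ ∪ opens h) (S.U₀ ∪ supp h)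
      freshOf_subset_edgeSet
      (fun e' he' => by rw [pinnedW_apply_of_mem_freshOf he', hpIval])
      (fun e' he' hne => mem_patternOf_of_pinnedW_ne_zero he' hne)
      (fun e' hne => forall_mem_of_pinnedW_ne_zero hne)
      (isLowerSet_pinReduce _ _ (hR.lower h e du)) (determinedBy_pinReduce _ _ _) hHT disjoint_revealed_freshOf hHI
  calc P.real (H ∩ {ω | ¬S.succ h e (Pr.read ω)})
      ≤ P.real (⋃ du ∈ dirs h e, bad h e du ∩ H) := by
        refine measureReal_mono (fun ω hω => ?_) (measure_ne_top _ _)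
        obtain ⟨hωH, hωf⟩ := hω
        have := hR.cover h Pr e hPr he hωf
        simp only [Set.mem_iUnion] at this ⊢
        obtain ⟨du, hdu', hωdu⟩ := this
        exact ⟨du, hdu', hωdu, hωH⟩
    _ ≤ ∑ du ∈ dirs h e, P.real (bad h e du ∩ H) := measureReal_biUnion_finset_le _ _
    _ ≤ ∑ du ∈ dirs h e, (pinnedLaw S q pI h (reg h e du)).real (bad h e du) * P.real H :=
        Finset.sum_le_sum hdu
    _ = pinnedFail S q dirs reg bad p' h e * P.real H := by rw [pinnedFail, Finset.sum_mul]

/-- **A pinned robustly lawful scheme is `LawLawful`** for the class of free box limits, with failure numbers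
`pinnedFail`, margin `δ = min{p/2, 1-p}` and Lipschitz constant `|MDir| · N/(δ(1-δ))` (`0 < p < 1`).
[cite: KozmaNitzan2024, §4 p. 25; Grimmett2006, Thm (2.43), Lemma (4.13)] -/
theorem lawLawful (hR : PinnedLawful S q p ε N dirs reg bad) (hp : (p : ℝ) ∈ Set.Ioo (0 : ℝ) 1) (hq : 1 ≤ q) :
    LawLawful S q (fun p' P' => IsBoxLimit d false p' q P') (pinnedFail S q dirs reg bad) p
      (min ((p : ℝ) / 2) (1 - p)) ((Fintype.card MDir : ℝ) * (N / (min ((p : ℝ) / 2) (1 - p) * (1 - min ((p : ℝ) / 2) (1 - p)))))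
      ε := by
  have hq0 : 0 < q := one_pos.trans_le hq
  set δ : ℝ := min ((p : ℝ) / 2) (1 - p) with hδ
  have hδ0 : 0 < δ := lt_min (by linarith [hp.1]) (by linarith [hp.2])
  have hδp : δ ≤ p / 2 := min_le_left _ _
  have hδ1 : δ ≤ 1 - p := min_le_right _ _
  have hδ1' : 0 < 1 - δ := by linarith [hp.1]
  -- parameters in the margin interval, as points of `[0,1]` and of `(0,1)`
  have hIcc01 : ∀ {x : ℝ}, x ∈ Set.Icc δ (1 - δ) → x ∈ Set.Icc (0 : ℝ) 1 := fun hx =>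
    ⟨hδ0.le.trans hx.1, hx.2.trans (by linarith)⟩
  have hIoo : ∀ {x : ℝ}, x ∈ Set.Icc δ (1 - δ) → x ∈ Set.Ioo (0 : ℝ) 1 := fun hx =>
    ⟨hδ0.trans_le hx.1, lt_of_le_of_lt hx.2 (by linarith)⟩
  have hproj : ∀ {x : ℝ} (hx : x ∈ Set.Icc (0 : ℝ) 1), ((Set.projIcc 0 1 zero_le_one x : unitInterval) : ℝ) = x :=
    fun hx => by rw [Set.projIcc_of_mem _ hx]
  have hpI : (p : ℝ) ∈ Set.Icc δ (1 - δ) := ⟨by linarith [hp.1], by linarith⟩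
  have hprojp : Set.projIcc (0 : ℝ) 1 zero_le_one (p : ℝ) = p := Set.projIcc_val zero_le_one p
  refine
    { probes := hR.probes
      init := exists_subset_edgesIn_of_subset_edgeSet hR.U₀_subset
      pos := hδ0
      mem_Ioc := ⟨by linarith [hp.1], hpI.2⟩
      nonneg := mul_nonneg (Nat.cast_nonneg _) (div_nonneg (Nat.cast_nonneg _) (mul_nonneg hδ0.le hδ1'.le))
      fail := fun h P e hP he => by
        simp only [pinnedFail, hprojp]
        exact hR.fail h P e hP he
      lipschitz := fun h P e hP he p' hp' => ?_
      dom := fun p' hp' P' _ hlim n h P e hP he => hR.dom hq (hIcc01 hp') hlim n hP he }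
  -- the Lipschitz estimate, direction by direction
  have hmin : δ * (1 - δ) ≤ min ((p : ℝ) * (1 - p)) (p' * (1 - p')) :=
    le_min (by nlinarith [hpI.1, hpI.2]) (by nlinarith [hp'.1, hp'.2])
  have hterm : ∀ du ∈ dirs h e,
      |(pinnedLaw S q (Set.projIcc 0 1 zero_le_one p') h (reg h e du)).real (bad h e du) -
          (pinnedLaw S q (Set.projIcc 0 1 zero_le_one (p : ℝ)) h (reg h e du)).real (bad h e du)| ≤
        N / (δ * (1 - δ)) * |p' - p| := by
    intro du hdu
    have h1 := pinnedLaw_abs_real_sub_le S hq0 (p₁ := Set.projIcc 0 1 zero_le_one (p : ℝ))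
      (p₂ := Set.projIcc 0 1 zero_le_one p') (by rw [hproj (hIcc01 hpI)]; exact hIoo hpI)
      (by rw [hproj (hIcc01 hp')]; exact hIoo hp') h (reg h e du) (hR.freshCard h P e hP he du hdu)
      (hR.determined h e du).measurableSet_of_finset
    rw [hproj (hIcc01 hpI), hproj (hIcc01 hp')] at h1
    refine h1.trans (mul_le_mul_of_nonneg_right ?_ (abs_nonneg _))
    exact div_le_div_of_nonneg_left (Nat.cast_nonneg _) (mul_pos hδ0 hδ1') hmin
  calc |pinnedFail S q dirs reg bad p' h e - pinnedFail S q dirs reg bad (p : ℝ) h e|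
      = |∑ du ∈ dirs h e, ((pinnedLaw S q (Set.projIcc 0 1 zero_le_one p') h (reg h e du)).real (bad h e du) -
          (pinnedLaw S q (Set.projIcc 0 1 zero_le_one (p : ℝ)) h (reg h e du)).real (bad h e du))| := by
        rw [pinnedFail, pinnedFail, Finset.sum_sub_distrib]
    _ ≤ ∑ du ∈ dirs h e, |(pinnedLaw S q (Set.projIcc 0 1 zero_le_one p') h (reg h e du)).real (bad h e du) -
          (pinnedLaw S q (Set.projIcc 0 1 zero_le_one (p : ℝ)) h (reg h e du)).real (bad h e du)| :=
        Finset.abs_sum_le_sum_abs _ _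
    _ ≤ ∑ du ∈ dirs h e, N / (δ * (1 - δ)) * |p' - p| := Finset.sum_le_sum hterm
    _ = (dirs h e).card * (N / (δ * (1 - δ)) * |p' - p|) := by rw [Finset.sum_const, nsmul_eq_mul]
    _ ≤ (Fintype.card MDir : ℝ) * (N / (δ * (1 - δ)) * |p' - p|) := by
        refine mul_le_mul_of_nonneg_right ?_ (mul_nonneg (div_nonneg (Nat.cast_nonneg _)
          (mul_nonneg hδ0.le hδ1'.le)) (abs_nonneg _))
        exact_mod_cast Finset.card_le_univ (dirs h e)
    _ = (Fintype.card MDir : ℝ) * (N / (δ * (1 - δ))) * |p' - p| := by ring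

/-- **C2 for pinned robustly lawful schemes — percolation at some `p′ < p`**: `ε < 2⁻³²`, `0 < p < 1`, `q ≥ 1`,
infinite macro-cluster forcing `0 ↔ ∞` ⇒ there is `p′ < p` at which every FREE box limit satisfying the `FKGibbs`
sandwich percolates. [cite: KozmaNitzan2024, §1 p. 2 (approach 1)] -/
theorem exists_lt_forall_percolates (hR : PinnedLawful S q p ε N dirs reg bad) (hε : ε < (1 / 2) ^ 32)
    (hp : (p : ℝ) ∈ Set.Ioo (0 : ℝ) 1) (hq : 1 ≤ q)
    (hperc : S.initEvent ∩ {ω | (S.occFinal ω).Infinite} ⊆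
      percolatesAt (0 : Site d) ∪ {ω | ¬ω ⊆ (zdGraph d).edgeSet}) :
    ∃ p' : ℝ, 0 < p' ∧ p' < p ∧ ∀ P : Measure (BondConfig (Site d)),
      FKGibbs d p' q P → IsBoxLimit d false p' q P → 0 < P.real (percolatesAt (0 : Site d)) := by
  obtain ⟨p', -, hp'0, hp'p, hall⟩ := (hR.lawLawful hp hq).exists_lt_forall_percolates hε hq hperc
  exact ⟨p', hp'0, hp'p, hall⟩

/-- **C2 for pinned robustly lawful schemes (cell `FKContinuationPrinciple`, modulo the existence of the free
box limit): `p_c(q) < p`.**  A pinned robustly lawful scheme at `(p, ε)` with `ε < 2⁻³²`, `0 < p < 1`, `q ≥ 1`,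
whose infinite final macro-cluster forces `0 ↔ ∞`, gives `p_c(q) < p` — provided that at every density in `[0,1]`
a free box limit satisfying the `FKGibbs` sandwich exists (cell rows FO-06a-2 `IsBoxLimit.fkGibbs` and FO-06b
`isBoxLimit_rcLimit`). [cite: KozmaNitzan2024, §1 p. 2 (approach 1), §4 p. 25] -/
theorem rcCriticalProb_lt (hR : PinnedLawful S q p ε N dirs reg bad) (hε : ε < (1 / 2) ^ 32)
    (hp : (p : ℝ) ∈ Set.Ioo (0 : ℝ) 1) (hq : 1 ≤ q)
    (hperc : S.initEvent ∩ {ω | (S.occFinal ω).Infinite} ⊆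
      percolatesAt (0 : Site d) ∪ {ω | ¬ω ⊆ (zdGraph d).edgeSet})
    (hex : ∀ p' ∈ Set.Icc (0 : ℝ) 1, ∃ P : Measure (BondConfig (Site d)),
      FKGibbs d p' q P ∧ IsBoxLimit d false p' q P) :
    rcCriticalProb d q < p :=
  (hR.lawLawful hp hq).rcCriticalProb_lt hε hq hperc hex

end PinnedLawful

/-- **No pinned robustly lawful bounded scheme at `p_c(q)`** (barrier sanity, row FO-12, for the pinned form):
under the existence input of `PinnedLawful.rcCriticalProb_lt` and `0 < p_c(q) < 1`, no history-driven scheme is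
pinned robustly lawful at `p = p_c(q)` with `ε < 2⁻³²` and an infinite macro-cluster forcing `0 ↔ ∞`.
[cite: KozmaNitzan2024, §1 p. 2 (approach 1)] -/
theorem not_pinnedLawful_rcCriticalProb {S : HSiteScheme (Site d)} {q : ℝ} (hq : 1 ≤ q)
    (hpc : rcCriticalProb d q ∈ Set.Ioo (0 : ℝ) 1)
    (hex : ∀ p' ∈ Set.Icc (0 : ℝ) 1, ∃ P : Measure (BondConfig (Site d)),
      FKGibbs d p' q P ∧ IsBoxLimit d false p' q P)
    {ε : ℝ} (hε : ε < (1 / 2) ^ 32) {N : ℕ}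
    {dirs : ProbeHistory (Site d) → Site 2 × MDir → Finset MDir}
    {reg : ProbeHistory (Site d) → Site 2 × MDir → MDir → Finset (Site d)}
    {bad : ProbeHistory (Site d) → Site 2 × MDir → MDir → Set (BondConfig (Site d))}
    (hperc : S.initEvent ∩ {ω | (S.occFinal ω).Infinite} ⊆
      percolatesAt (0 : Site d) ∪ {ω | ¬ω ⊆ (zdGraph d).edgeSet}) :
    ¬PinnedLawful S q ⟨rcCriticalProb d q, hpc.1.le, hpc.2.le⟩ ε N dirs reg bad := fun hR =>
  lt_irrefl _ (hR.rcCriticalProb_lt hε hpc hq hperc hex)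

end SameP

end Summit.CriticalPhenomena.PercolationContinuityZ3.Theorems.FK

end
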